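import Mathlib
import Summits.ResolutionOfSingularities.ResolutionOfSingularities.Theorems.RadicialJungCleanModelsContactChainCapstone
import Summits.ResolutionOfSingularities.ResolutionOfSingularities.Theorems.RadicialJungCleanModelsExcellentDefectless
import Literature.AlgebraicGeometry.Resolution.Temkin2008OfHironaka
import Literature.AlgebraicGeometry.Resolution.ExcellentBlowup
import Summits.ResolutionOfSingularities.ResolutionOfSingularities.Theorems.RadicialJungCleanModelsCleanPermissibleSeq
import HarnessLib

/-!
# Route `RadicialJung`, crux `CleanModels` (stmt-ResolutionOfSingularities-15917), line `Sketch` rev 35, stub 6 `stub_cleanProp44` (X44c),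
# work plan O8 / L7b — the CAPSTONE on (quasi-)excellent schemes, WITHOUT the defectlessness hypothesis

Memo `Cruxes/CleanModels/Lines/Sketch-memo-hand2-g8-stubs-5-7.md` §2 (T1-fact) / §4 (i).  The capstone ✓ `exists_pointChain_cleanPermissibleAt_or_pthPower_of_cleanRegAt`
(p813775) and ✓ `exists_pointChain_cleanPermissibleAt_of_isDefectlessField` (p813508) assumed `hdef`: «the valued field `(Frac 𝒪_{C₀,x₀}, 𝒪_{C₀,x₀})` is
defectless».  On a quasi-excellent scheme `X₀` (X44c's stages `X → S` are of finite type over the excellent `S`, hence excellent: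
✓ `Scheme.IsExcellent.of_locallyOfFiniteType`) this hypothesis HOLDS: `𝒪_{X₀,x₀}` is quasi-excellent (✓ `Scheme.IsQuasiExcellent.isQuasiExcellentRing_stalk`),
so is its quotient `𝒪_{C₀,x₀}` — a discrete valuation ring since `C₀` is a regular curve through the regular point `x₀` — and quasi-excellent
discrete valuation rings are defectless (✓ `isDefectlessField_quotient_of_isQuasiExcellentRing`, `…ExcellentDefectless.lean`: Japanese + `∑ eᵢfᵢ = n`).

* `isDefectlessField_curve_of_isQuasiExcellent` — the literal `hdef` at a point `x₀` (`dim 𝒪_{X₀,x₀} = 3`) of a regular curve `C₀` on a regular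
  quasi-excellent `X₀`;
* `exists_pointChain_cleanPermissibleAt_of_isQuasiExcellent` — ✓ p813508 without `hdef`;
* `exists_pointChain_cleanPermissibleAt_or_pthPower_of_cleanRegAt_of_isQuasiExcellent` — THE CAPSTONE without `hdef`: on a regular integral
  quasi-excellent `X₀` (`char K(X₀) = p`), `CleanRegAt p (toFunctionField x₀) G` at a closed point of a regular curve ⟹ a dominant point-blow-up
  chain following the curve with a clean-permissible landing ∨ the all-transversal uncharged representative is residually a `p`-th power along the
  curve (the (T2) entry of the memo).

What remains of O8 (L7b) after this file: ONLY the sub-case (T2) of the memo ((T2a) is ✓ p812527; (T2b) open), no valuation-theoretic input.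
Honest framing: OURS; nothing here proves resolution in characteristic `p`, X44c, or any case of `CleanModels`.
-/

noncomputable section

set_option linter.dupNamespace false -- mandated namespace of this single-conjunct summit

open CategoryTheory AlgebraicGeometry TopologicalSpace IsLocalRing
open Literature.AlgebraicGeometry.Resolution Literature.AlgebraicGeometry.Motives
open Scheme.IdealSheafData

namespace Summit.ResolutionOfSingularities.ResolutionOfSingularities.Theorems.RadicialJung.CleanModels

/-- **`hdef` holds on quasi-excellent schemes.**  At a point `x₀` with `dim 𝒪_{X₀,x₀} = 3` of a quasi-excellent scheme `X₀`, through which the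
closed subset `C₀` is a regular curve (its ideal generated by a pair of regular parameters — so `𝒪_{X₀,x₀}` is regular), the valued field
`(Frac 𝒪_{C₀,x₀}, 𝒪_{C₀,x₀})`, `𝒪_{C₀,x₀} = 𝒪_{X₀,x₀}/𝓘_{C₀,x₀}`, is defectless. [cite: Kuhlmann2010, Section 1 (p. 3 of arXiv:1003.5678)]
[cite: EGAIV2, (7.8.3) (vi) with (7.6.4) and (7.7.2)] [cite: Matsumura1987, Thm. 14.2] -/
theorem isDefectlessField_curve_of_isQuasiExcellent {X₀ : Scheme.{0}} (hE : Scheme.IsQuasiExcellent X₀)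
    {C₀ : Closeds X₀} {x₀ : X₀}
    (hC₀reg : ∃ c : Fin 2 → X₀.presheaf.stalk x₀, IsRsopPart c ∧ Ideal.span (Set.range c) = stalkIdeal (vanishingIdeal C₀) x₀)
    (hdim₀ : ringKrullDim (X₀.presheaf.stalk x₀) = 3) [hP : (stalkIdeal (vanishingIdeal C₀) x₀).IsPrime] :
    ∀ W : ValuationSubring (FractionRing (X₀.presheaf.stalk x₀ ⧸ stalkIdeal (vanishingIdeal C₀) x₀)),
      (∀ x, x ∈ W ↔ ∃ d : X₀.presheaf.stalk x₀ ⧸ stalkIdeal (vanishingIdeal C₀) x₀,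
        algebraMap _ (FractionRing (X₀.presheaf.stalk x₀ ⧸ stalkIdeal (vanishingIdeal C₀) x₀)) d = x) →
      IsDefectlessField (FractionRing (X₀.presheaf.stalk x₀ ⧸ stalkIdeal (vanishingIdeal C₀) x₀)) W := by
  obtain ⟨c, hc, hcP⟩ := hC₀reg
  haveI : IsRegularLocalRing (X₀.presheaf.stalk x₀ ⧸ stalkIdeal (vanishingIdeal C₀) x₀) := by
    rw [← hcP]; exact hc.isRegularLocalRing_quotient
  have hP1 : ringKrullDim (X₀.presheaf.stalk x₀ ⧸ stalkIdeal (vanishingIdeal C₀) x₀) = 1 := by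
    rw [← hcP]; exact ringKrullDim_quotient_span_pair_eq_one hc hdim₀
  haveI : IsDiscreteValuationRing (X₀.presheaf.stalk x₀ ⧸ stalkIdeal (vanishingIdeal C₀) x₀) :=
    isDiscreteValuationRing_of_isRegularLocalRing_of_ringKrullDim_eq_one _ hP1
  exact isDefectlessField_quotient_of_isQuasiExcellentRing (hE.isQuasiExcellentRing_stalk x₀) _

/-- **L7b exit for the all-transversal uncharged configuration on a quasi-excellent scheme** — ✓ `exists_pointChain_cleanPermissibleAt_of_isDefectlessField`
(p813508) with its defectlessness hypothesis DISCHARGED by quasi-excellence of `X₀`. [cite: CossartJannsenSaito2020, proof of Thm. 6.28, Step 5]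
[cite: Kuhlmann2010, Section 1 (p. 3 of arXiv:1003.5678)] [cite: EGAIV2, (7.8.3) (vi) with (7.6.4) and (7.7.2)] -/
theorem exists_pointChain_cleanPermissibleAt_of_isQuasiExcellent {X₀ : Scheme.{0}} [IsIntegral X₀] [IsLocallyNoetherian X₀]
    (hX₀ : Scheme.IsRegular X₀) (hE : Scheme.IsQuasiExcellent X₀) (p : ℕ) [Fact p.Prime] [CharP X₀.functionField p] {C₀ : Closeds X₀}
    (hC₀reg : ∀ y ∈ (C₀ : Set X₀), ∃ c : Fin 2 → X₀.presheaf.stalk y,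
      IsRsopPart c ∧ Ideal.span (Set.range c) = stalkIdeal (vanishingIdeal C₀) y)
    {x₀ : X₀} (hx₀ : IsClosed ({x₀} : Set X₀)) (hx₀C : x₀ ∈ (C₀ : Set X₀)) (hdim₀ : ringKrullDim (X₀.presheaf.stalk x₀) = 3)
    [hP : (stalkIdeal (vanishingIdeal C₀) x₀).IsPrime]
    (G : X₀.functionField) (cc : Fin p → X₀.functionField) (hcc : ∃ j : Fin p, (j : ℕ) ≠ 0 ∧ cc j ≠ 0)
    (w u₀ : X₀.presheaf.stalk x₀) (hw : stalkIdeal (vanishingIdeal C₀) x₀ ⊔ Ideal.span {w} = maximalIdeal _) (hu₀ : IsUnit u₀)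
    {m : ℕ} (γ s₀ : Fin m → X₀.presheaf.stalk x₀) (hγ : ∀ i, IsUnit (γ i))
    (hs₀ : ∀ i, s₀ i ∈ stalkIdeal (vanishingIdeal C₀) x₀) (k a : Fin m → ℕ) {N' : ℕ} (hN : ∑ i, k i * a i = N' * p)
    (hX : (∑ j : Fin p, cc j ^ p * G ^ (j : ℕ)) = RatFn.toFunctionField x₀ (u₀ * ∏ i, (γ i * w ^ k i + s₀ i) ^ a i))
    (hv : ∀ c : X₀.presheaf.stalk x₀, u₀ * ∏ i, γ i ^ a i - c ^ p ∉ stalkIdeal (vanishingIdeal C₀) x₀) :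
    ∃ (X : Scheme.{0}) (_ : IsIntegral X) (_ : IsLocallyNoetherian X) (σ : X ⟶ X₀) (_ : IsDominant σ) (C : Closeds X) (x : X) (n : ℕ),
      IsPointChainAlong σ C₀ C x n ∧ σ x = x₀ ∧ IsClosed ({x} : Set X) ∧
      CleanPermissibleAt p (RatFn.toFunctionField x) (RatFn.functionFieldMap σ G) (stalkIdeal (vanishingIdeal C) x) :=
  exists_pointChain_cleanPermissibleAt_of_isDefectlessField hX₀ p hC₀reg hx₀ hx₀C hdim₀ G cc hcc w u₀ hw hu₀ γ s₀ hγ hs₀ k a hN hX hv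
    (isDefectlessField_curve_of_isQuasiExcellent hE (hC₀reg x₀ hx₀C) hdim₀)

/-- **L7b CAPSTONE on quasi-excellent schemes (no defectlessness hypothesis).**  `X₀` regular integral locally Noetherian and QUASI-EXCELLENT
(universe `0`), `char K(X₀) = p`, `C₀` a regular curve through the closed point `x₀` (`dim 𝒪_{X₀,x₀} = 3`), `w` transversal, and
`CleanRegAt p (toFunctionField x₀) G`.  Then EITHER a dominant chain of point blowing ups following `C₀` ends at a point where the line of `σ^♯ G` is
clean-permissible for the strict transform, OR the line has an all-transversal representative `u · ∏ s_i^{a_i}` (`s_i = γ_i w^{k_i} + π_i`,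
`p ∣ Σ k_i a_i`) whose unit part `u ∏ γ_i^{a_i}` is a `p`-th power MODULO `𝓘_{C₀,x₀}` (the memo's (T2) entry).  = ✓ p813775 with `hdef` supplied by
`isDefectlessField_curve_of_isQuasiExcellent`. [cite: CossartJannsenSaito2020, proof of Thm. 6.28, Step 5] [cite: Kuhlmann2010, Section 1 (p. 3)]
[cite: EGAIV2, (7.8.3) (vi) with (7.6.4) and (7.7.2)] [cite: Piltant2013, §2 Axiom 4] -/
theorem exists_pointChain_cleanPermissibleAt_or_pthPower_of_cleanRegAt_of_isQuasiExcellent {X₀ : Scheme.{0}} [IsIntegral X₀]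
    [IsLocallyNoetherian X₀] (hX₀ : Scheme.IsRegular X₀) (hE : Scheme.IsQuasiExcellent X₀) (p : ℕ) [Fact p.Prime] [CharP X₀.functionField p]
    {C₀ : Closeds X₀}
    (hC₀reg : ∀ y ∈ (C₀ : Set X₀), ∃ c : Fin 2 → X₀.presheaf.stalk y,
      IsRsopPart c ∧ Ideal.span (Set.range c) = stalkIdeal (vanishingIdeal C₀) y)
    {x₀ : X₀} (hx₀ : IsClosed ({x₀} : Set X₀)) (hx₀C : x₀ ∈ (C₀ : Set X₀)) (hdim₀ : ringKrullDim (X₀.presheaf.stalk x₀) = 3)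
    [hP : (stalkIdeal (vanishingIdeal C₀) x₀).IsPrime]
    (w : X₀.presheaf.stalk x₀) (hw : stalkIdeal (vanishingIdeal C₀) x₀ ⊔ Ideal.span {w} = maximalIdeal _)
    (G : X₀.functionField) (hG : CleanRegAt p (RatFn.toFunctionField x₀) G) :
    (∃ (X : Scheme.{0}) (_ : IsIntegral X) (_ : IsLocallyNoetherian X) (σ : X ⟶ X₀) (_ : IsDominant σ) (C : Closeds X) (x : X)
        (n : ℕ), IsPointChainAlong σ C₀ C x n ∧ σ x = x₀ ∧ IsClosed ({x} : Set X) ∧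
        CleanPermissibleAt p (RatFn.toFunctionField x) (RatFn.functionFieldMap σ G) (stalkIdeal (vanishingIdeal C) x)) ∨
      ∃ (cc : Fin p → X₀.functionField) (m : ℕ) (s : Fin m → X₀.presheaf.stalk x₀) (a : Fin m → ℕ) (u : X₀.presheaf.stalk x₀)
        (γ π : Fin m → X₀.presheaf.stalk x₀) (k : Fin m → ℕ) (c : X₀.presheaf.stalk x₀),
        (∃ j : Fin p, (j : ℕ) ≠ 0 ∧ cc j ≠ 0) ∧ IsRsopPart s ∧ (∀ i, ¬ p ∣ a i) ∧ IsUnit u ∧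
        (∑ j : Fin p, cc j ^ p * G ^ (j : ℕ)) = RatFn.toFunctionField x₀ (u * ∏ i, s i ^ a i) ∧
        (∀ i, s i ∉ stalkIdeal (vanishingIdeal C₀) x₀) ∧ (∀ i, IsUnit (γ i)) ∧
        (∀ i, π i ∈ stalkIdeal (vanishingIdeal C₀) x₀) ∧ (∀ i, s i = γ i * w ^ k i + π i) ∧ p ∣ ∑ i, k i * a i ∧
        u * ∏ i, γ i ^ a i - c ^ p ∈ stalkIdeal (vanishingIdeal C₀) x₀ :=
  exists_pointChain_cleanPermissibleAt_or_pthPower_of_cleanRegAt hX₀ p hC₀reg hx₀ hx₀C hdim₀ w hw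
    (isDefectlessField_curve_of_isQuasiExcellent hE (hC₀reg x₀ hx₀C) hdim₀) G hG

/-- The EXCELLENT form (X44c's stages are excellent: of finite type over the excellent base `S`, ✓ `Scheme.IsExcellent.of_locallyOfFiniteType`):
the `hdef` of the capstone at a point of a regular curve on an excellent scheme. [cite: EGAIV2, (7.8.3) (vi) with (7.6.4) and (7.7.2)]
[cite: Kuhlmann2010, Section 1 (p. 3 of arXiv:1003.5678)] -/
theorem isDefectlessField_curve_of_isExcellent {X₀ : Scheme.{0}} (hE : Scheme.IsExcellent X₀)
    {C₀ : Closeds X₀} {x₀ : X₀}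
    (hC₀reg : ∃ c : Fin 2 → X₀.presheaf.stalk x₀, IsRsopPart c ∧ Ideal.span (Set.range c) = stalkIdeal (vanishingIdeal C₀) x₀)
    (hdim₀ : ringKrullDim (X₀.presheaf.stalk x₀) = 3) [hP : (stalkIdeal (vanishingIdeal C₀) x₀).IsPrime] :
    ∀ W : ValuationSubring (FractionRing (X₀.presheaf.stalk x₀ ⧸ stalkIdeal (vanishingIdeal C₀) x₀)),
      (∀ x, x ∈ W ↔ ∃ d : X₀.presheaf.stalk x₀ ⧸ stalkIdeal (vanishingIdeal C₀) x₀,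
        algebraMap _ (FractionRing (X₀.presheaf.stalk x₀ ⧸ stalkIdeal (vanishingIdeal C₀) x₀)) d = x) →
      IsDefectlessField (FractionRing (X₀.presheaf.stalk x₀ ⧸ stalkIdeal (vanishingIdeal C₀) x₀)) W :=
  isDefectlessField_curve_of_isQuasiExcellent hE.isQuasiExcellent hC₀reg hdim₀

/-- **The stages of X44c are excellent.**  Along a Cossart–Piltant sequence `σ : S' → S` of blowing ups in regular centres (`IsRegularCentreBlowupSeq`,
in particular along a clean-permissible one, `IsCleanRegularCentreBlowupSeq.isRegularCentreBlowupSeq`) over a locally Noetherian EXCELLENT `S`, the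
top `S'` is locally Noetherian and excellent (each blowing up is proper, ✓ `IsBlowup.isExcellent`).  Hence the capstone
`exists_pointChain_cleanPermissibleAt_or_pthPower_of_cleanRegAt_of_isQuasiExcellent` applies on every stage `X → S` of the registered stub
`stub_cleanProp44` (X44c: `S` regular excellent, `IsCleanRegularCentreBlowupSeq p ρ I G₀`). [cite: Matsumura1987, §32 p. 260]
[cite: CossartPiltant2019, Prop. 4.4 (i)] -/
theorem isLocallyNoetherian_and_isExcellent_of_isRegularCentreBlowupSeq {S' S : Scheme.{0}} [IsIntegral S'] [IsIntegral S] {σ : S' ⟶ S}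
    [IsDominant σ] {J : S.IdealSheafData} (h : IsRegularCentreBlowupSeq σ J) :
    IsLocallyNoetherian S → Scheme.IsExcellent S → IsLocallyNoetherian S' ∧ Scheme.IsExcellent S' := by
  induction h with
  | nil J => exact fun hN hE => ⟨hN, hE⟩
  | cons τ σ J Y _ _ _ _ hτ ih =>
    intro hN hE
    obtain ⟨hN', hE'⟩ := ih hN hE
    haveI := hN'
    exact ⟨hτ.isLocallyNoetherian', hτ.isExcellent hE'⟩

/-- The clean-permissible form: every stage `X → S` of X44c (`IsCleanRegularCentreBlowupSeq p ρ I G₀` over a Noetherian excellent `S`) is an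
excellent scheme. [cite: Matsumura1987, §32 p. 260] [cite: CossartPiltant2019, Prop. 4.4 (i)] -/
theorem isExcellent_of_isCleanRegularCentreBlowupSeq {p : ℕ} {X S : Scheme.{0}} [IsIntegral X] [IsIntegral S] [IsLocallyNoetherian S]
    {ρ : X ⟶ S} [IsDominant ρ] {I : S.IdealSheafData} {G₀ : S.functionField} (h : IsCleanRegularCentreBlowupSeq p ρ I G₀)
    (hE : Scheme.IsExcellent S) : Scheme.IsExcellent X :=
  ((isLocallyNoetherian_and_isExcellent_of_isRegularCentreBlowupSeq h.isRegularCentreBlowupSeq) inferInstance hE).2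

end Summit.ResolutionOfSingularities.ResolutionOfSingularities.Theorems.RadicialJung.CleanModels

end
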